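/-
Copyright (c) 2026 the pub-hodgecm-mathlib formalisation cell (harness21).  Prover seat hodgecm-mathlib-K2E1-p12 (g2), Track B ∕ K2-LIT, h413 =
`stmt-HodgeConjecture-24833`, line `K2_E1_TraceFormulaBeta`, (137)∕P4 «N = 2 RES-chain print», part 5 — the `N = 2` twin (`U(J₂)`, pole `1`, exponent `1 − z`) of ★ K2E4-p10 (g6)
`K2E1SphericalEisensteinHeckeLinkFixedLevelUThree`: the HECKE LINK AT A FIXED TRUNCATION LEVEL between the operator road's `L²`-valued family `F_T(z) =ᵐ Λ^T Ẽ(z)` and the point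
values `Ẽ(z)(g)` on `U(J₂)` — `L²` bounds ⟹ pointwise bounds (pole exclusion `hbdd`, the simple-pole letter (F) at `1`) (dealer K2E1-plan (g7) (137)∕(182), 2026-09-04).
-/
import Summits.HodgeConjecture.HodgeConjecture.Theorems.K2E1SphericalEisensteinResidueLinkU               -- ★ p859494 (K2E4-p10): `exists_evalCLM_L2` (★ P3-D on `L²(μ)`); brings the removable-singularity brick ★ p859366
import Summits.HodgeConjecture.HodgeConjecture.Theorems.K2E1ContinuedEisensteinResidueFunctionUTwo         -- THIS SEAT ★ p859977: `truncation_continued_apply` (the Siegel-top formula, `N = 2`)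
import Literature.NumberTheory.Automorphic.UnitaryGroupKernelDictionary                                   -- ★ `quotientSubgroup_quasiSplit`
import HarnessLib

/-!
# K2·E1 — `K2E1SphericalEisensteinHeckeLinkFixedLevelUTwo` (`U(J₂)_{E/F}`): THE HECKE LINK AT A FIXED TRUNCATION LEVEL `ĥ(z)·Ẽ(z)(g) = Λ_g(F_T(z)) + R_g(z)` AND ITS TWO USES —
# `L²` BOUNDS ON THE TRUNCATED FAMILY GIVE POINTWISE BOUNDS ON `Ẽ(z)(g)`: POLE EXCLUSION OFF `1` (the letter `hbdd`) AND THE SIMPLE-POLE LETTER (F) AT `1`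

Track B ∕ K2-LIT, crux h413 = `stmt-HodgeConjecture-24833`, route of record `HCCMUnconditional`; cell `hodgecm-mathlib`, squad K2, ENGINE E1.  Prover seat `hodgecm-mathlib-K2E1-p12` (g2);
deal (137)∕P4 of the dealer K2E1-plan (g7) (the `N = 2` RES-chain: ★ p859977 · ★ p860033 · ★ p860015 · ★ p860044 · ★ p860068 · ★ p860098; this file pays the chain's pole letter (F) at
`1` and the pointwise `hbdd` from the operator road's `L²` bounds).  THEOREMS ONLY (no `def`, no `instance`, no notation, no named-fact hypothesis, no `sorry`); lane `--supports
stmt-HodgeConjecture-24833 --as helper` (count-neutral).  Closes no socket.  Generic CM-type extension `E/F` (`quasiSplit F E c 2`).  The byte-for-byte `N = 2` twin of ★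
`K2E1SphericalEisensteinHeckeLinkFixedLevelUThree` with `3 ↦ 2`, pole `2 ↦ 1`, exponent `2 − z ↦ 1 − z` (bound `B^{|1−Re z|}`, `|(1−z).re| ≤ |Re z₀| + 2`), binders `hcc2 hMS2 hEd2 ↦
hcc1 hMS1 hEd1`; the Siegel-top formula is ★ p859977's `truncation_continued_apply` (`N = 2`).

THE MATHEMATICS ([BernsteinLapid2019, §4 p. 10]; [MoeglinWaldspurger1995, IV.1.9–IV.1.11, I.2.13]).  The operator road delivers the truncated family at ONE level `T ≥ 1`: `F_T : D → L²(μ)`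
holomorphic with `F_T(z) =ᵐ Λ^T Ẽ(z)`.  For `h ∈ C_c(G(𝔸))` real and `g ∈ G(𝔸)`, ★ P3-D's bounded functional `Λ_g[u] = ∫ h(y)u(gy) dν_G` on `L²(μ)` gives `Λ_g(F_T(z)) = ∫ h(y)·Λ^TẼ(z)(gy) dν_G`,
and by the SIEGEL-TOP FORMULA (★ p859977) `Λ^TẼ(z)(x) = Ẽ(z)(x) − 𝟙[T < w(x)]·φ₀(w(x)^z + c̃(z)w(x)^{1−z})` (continued constant term (E3′)₂); with the continued Hecke relation (Hk)
`∫ h(y)Ẽ(z)(gy) = ĥ(z)Ẽ(z)(g)` this is **`ĥ(z)·Ẽ(z)(g) = Λ_g(F_T(z)) + R_g(z)`, `R_g(z) = ∫ h(y)𝟙[T < w(gy)]φ₀(w(gy)^z + c̃(z)w(gy)^{1−z}) dν_G`** (§1), where `1 ≤ w ≤ B` on the support (so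
`|R_g(z)| ≤ ‖h‖₁‖φ₀‖(B^{|Re z|} + |c̃(z)|B^{|1−Re z|})`).  Hence (§2) for a weight `a(z)` bounded near `z₀` (`a ≡ 1`, or `a(z) = z − 1` at the pole): `L²` bounds `‖a(z)•F_T(z)‖ ≤ C` and
`|a(z)c̃(z)| ≤ C` near `z₀` with `ĥ(z₀) ≠ 0` give `|a(z)Ẽ(z)(g)| ≤ C'` near `z₀` — the POINTWISE pole exclusion `hbdd` of ★ `hreg_cm_two_of_letters` (`a ≡ 1`, `z₀ ∈ P∖{1}`) and the
simple-pole letter (F) of ★ p859977∕p860098 (`a(z) = z − 1`, ★ removable-singularity brick).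
HONEST LABEL: HC_CM is proved only modulo the 7 printed citations (2 remaining named inputs: hLiu418 = `stmt-HodgeConjecture-24832`, h413 = `stmt-HodgeConjecture-24833`) until rung 0
closes; this file asserts no named fact and closes no socket; its heads are CONDITIONAL on (Hk), (E3′)₂, `hEcinv` (EXPORTS₂) and the operator road's `(F_T, hFam)` + `L²` bounds at `N = 2`.
References: [BernsteinLapid2019] §4 p. 10 · [MoeglinWaldspurger1995] I.2.13, IV.1.9–IV.1.11 · [Langlands1976] §7 · [GetzHahn2024] Lemma 9.2.4.
-/

set_option autoImplicit false
-- the mandated namespace repeats the single-problem summit's segment (`HodgeConjecture.HodgeConjecture`)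
set_option linter.dupNamespace false

noncomputable section

open MeasureTheory Measure NumberField IsDedekindDomain Set Filter Topology Metric
open scoped ENNReal NNReal Pointwise
open Literature.NumberTheory.Automorphic Literature.NumberTheory.Automorphic.UnitaryGroup AdelicGroupData
open Summit.HodgeConjecture.HodgeConjecture.Cruxes.H413.K2E1BLBorelSpacesU2Defs
open Summit.HodgeConjecture.HodgeConjecture.Cruxes.H413.K2E1BLHeckeOperatorHXU2 (supHeight_toAutomorphicQuotient measurable_supHeight)
open Summit.HodgeConjecture.HodgeConjecture.Cruxes.H413.K2E1BLRemovablePolesU (exists_analyticAt_eventuallyEq_of_differentiableAt_of_eventually_norm_le)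
open Summit.HodgeConjecture.HodgeConjecture.Cruxes.H413.K2E1SphericalEisensteinResidueLinkU (exists_evalCLM_L2)
open Summit.HodgeConjecture.HodgeConjecture.Cruxes.H413.K2E1ContinuedEisensteinResidueFunctionUTwo (truncation_continued_apply)

namespace Summit.HodgeConjecture.HodgeConjecture.Cruxes.H413.K2E1SphericalEisensteinHeckeLinkFixedLevelUTwo

variable {F E : Type} [Field F] [NumberField F] [Field E] [NumberField E] [Algebra F E] {c : E ≃ₐ[F] E}
variable [MeasurableSpace (quasiSplit F E c 2).Adelic] [BorelSpace (quasiSplit F E c 2).Adelic]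

/-! ## §1 A uniform height bound on `g·supp h`, and the Hecke link at a fixed level -/

section Link

omit [MeasurableSpace (quasiSplit F E c 2).Adelic] [BorelSpace (quasiSplit F E c 2).Adelic] in
/-- **`w₁ ≤ B` ON `g·supp h`** (`B ≥ 1`): the top height `w[(x)⁻¹] = sup_γ H(γx)` is bounded on the compact `g·supp h` (★ `borelHeight_rational_mul_le` + ★ `exists_matHeightBound_le_of_isCompact`).
[cite: Garrett2018, Cor. 3.3.3] [cite: BernsteinLapid2019, §4 p. 10] -/
theorem exists_forall_supHeight_le_of_hasCompactSupport {h : (quasiSplit F E c 2).Adelic → ℝ} (hhc : HasCompactSupport h) (g : (quasiSplit F E c 2).Adelic) :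
    ∃ B : ℝ≥0, 1 ≤ B ∧ ∀ y ∈ tsupport h, supHeight F E c 2 ((quasiSplit F E c 2).toAutomorphicQuotient (g * y)⁻¹) ≤ B := by
  haveI := t2Space_adeleRing_of_numberField E
  haveI : T2Space (quasiSplit F E c 2).Adelic := inferInstanceAs (T2Space (adelic F E c 2 ((StdForm.antidiagonal 2).over E)))
  have hC : IsCompact ((fun ω : (quasiSplit F E c 2).Adelic =>
      ((adelicVal F E c 2 _ ω : GL (Fin 2) (AdeleRing (𝓞 E) E)) : Matrix (Fin 2) (Fin 2) (AdeleRing (𝓞 E) E))) '' ({g} * tsupport h)⁻¹) :=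
    ((isCompact_singleton (x := g)).mul hhc.isCompact).inv.image (Units.continuous_val.comp continuous_subtype_val)
  obtain ⟨B, hB⟩ := exists_matHeightBound_le_of_isCompact (K := E) hC
  refine ⟨max B 1, le_max_right _ _, fun y hy => ?_⟩
  rw [supHeight_toAutomorphicQuotient, inv_inv]
  refine (ciSup_le fun γ => ?_).trans (le_max_left _ _)
  refine (borelHeight_rational_mul_le γ (g * y)).trans (hB _ ⟨(g * y)⁻¹, Set.inv_mem_inv.2 (Set.mul_mem_mul (Set.mem_singleton g) hy), ?_⟩)
  simp only [map_inv]

variable (μ : Measure (quasiSplit F E c 2).automorphicQuotient) [(quasiSplit F E c 2).IsAutomorphicMeasure μ]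
  (νG : Measure (quasiSplit F E c 2).Adelic) [νG.IsHaarMeasure] [νG.IsInvInvariant]

/-- **THE HECKE LINK AT A FIXED TRUNCATION LEVEL.**  `T ≥ 1`; `h ∈ C_c(G(𝔸))` real; `ν, 𝓕` (Haar on `N(𝔸)`, fundamental domain); on a set `S` of parameters the continued values `Ẽ` are
left-`G(F)`-invariant, satisfy the continued Hecke relation (Hk) with eigenvalue `ĥ` and the continued constant term (E3′); `F_T(z) =ᵐ Λ^T Ẽ(z)` in `L²(μ)` for `z ∈ S`.  THEN there is ONE
bounded functional `Λ_g` on `L²(μ)` (★ P3-D), with `Λ_g 𝟙 = ∫ h dν_G`, such that for every `z ∈ S`: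
`ĥ(z)·Ẽ(z)(g) = Λ_g(F_T(z)) + ∫ h(y)·𝟙[T < w₁[(gy)⁻¹]]·φ₀(w₁^z + c̃(z)w₁^{1−z}) dν_G(y)` (Siegel-top ★ + (Hk)). [cite: BernsteinLapid2019, §4 p. 10] [cite: MoeglinWaldspurger1995, I.2.13, IV.1.9] -/
theorem exists_clm_hecke_link (ν : Measure ↥(adelicUnipotent F E c 2)) [ν.IsHaarMeasure] {𝓕 : Set ↥(adelicUnipotent F E c 2)}
    (h𝓕 : IsFundamentalDomain ↥(rationalUnipotent F E c 2) 𝓕 ν) {T : ℝ≥0} (hT : 1 ≤ T) (φ₀ : ℂ)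
    {h : (quasiSplit F E c 2).Adelic → ℝ} (hh : Continuous h) (hhc : HasCompactSupport h) (hhat : ℂ → ℂ)
    (Ec : ℂ → (quasiSplit F E c 2).Adelic → ℂ) (S : Set ℂ)
    (hEcinv : ∀ z ∈ S, ∀ (γ : (quasiSplit F E c 2).arithmeticSubgroup) (x : (quasiSplit F E c 2).Adelic), Ec z ((γ : (quasiSplit F E c 2).Adelic) * x) = Ec z x)
    (hHk : ∀ z ∈ S, ∀ g : (quasiSplit F E c 2).Adelic, ∫ y, ((h y : ℝ) : ℂ) * Ec z (g * y) ∂νG = hhat z * Ec z g)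
    (cc : ℂ → ℂ) (hE3 : ∀ z ∈ S, ∀ g : (quasiSplit F E c 2).Adelic,
      borelConstantTerm ν 𝓕 (Ec z) g = φ₀ * ((((borelHeight g : ℝ≥0) : ℝ) : ℂ) ^ z + cc z * (((borelHeight g : ℝ≥0) : ℝ) : ℂ) ^ (1 - z)))
    (Fam : ℂ → (quasiSplit F E c 2).L2 μ)
    (hFam : ∀ z ∈ S, ((Fam z : (quasiSplit F E c 2).L2 μ) : (quasiSplit F E c 2).automorphicQuotient → ℂ) =ᵐ[μ] (quasiSplit F E c 2).quotFun (truncation ν 𝓕 T (Ec z)))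
    (g : (quasiSplit F E c 2).Adelic) :
    ∃ Λ : (quasiSplit F E c 2).L2 μ →L[ℂ] ℂ, Λ (Lp.const 2 μ (1 : ℂ)) = ∫ y, ((h y : ℝ) : ℂ) ∂νG ∧
      (∀ z ∈ S, Integrable (fun y => ((h y : ℝ) : ℂ) * (if T < supHeight F E c 2 ((quasiSplit F E c 2).toAutomorphicQuotient (g * y)⁻¹) then
        φ₀ * ((((supHeight F E c 2 ((quasiSplit F E c 2).toAutomorphicQuotient (g * y)⁻¹) : ℝ≥0) : ℝ) : ℂ) ^ z +
          cc z * (((supHeight F E c 2 ((quasiSplit F E c 2).toAutomorphicQuotient (g * y)⁻¹) : ℝ≥0) : ℝ) : ℂ) ^ (1 - z)) else 0)) νG) ∧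
      ∀ z ∈ S, hhat z * Ec z g = Λ (Fam z) + ∫ y, ((h y : ℝ) : ℂ) * (if T < supHeight F E c 2 ((quasiSplit F E c 2).toAutomorphicQuotient (g * y)⁻¹) then
        φ₀ * ((((supHeight F E c 2 ((quasiSplit F E c 2).toAutomorphicQuotient (g * y)⁻¹) : ℝ≥0) : ℝ) : ℂ) ^ z +
          cc z * (((supHeight F E c 2 ((quasiSplit F E c 2).toAutomorphicQuotient (g * y)⁻¹) : ℝ≥0) : ℝ) : ℂ) ^ (1 - z)) else 0) ∂νG := by
  obtain ⟨Λ, hΛ⟩ := exists_evalCLM_L2 μ νG hh hhc g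
  -- `Λ 𝟙 = ∫ h`
  have h1G : ∀ γ ∈ (quasiSplit F E c 2).quotientSubgroup, ∀ y, (fun _ : (quasiSplit F E c 2).Adelic => (1 : ℂ)) (γ * y) = (fun _ => (1 : ℂ)) y := fun _ _ _ => rfl
  have h1m : MemLp ((quasiSplit F E c 2).quotFun fun _ : (quasiSplit F E c 2).Adelic => (1 : ℂ)) 2 μ := memLp_const (1 : ℂ)
  have hc1 : (Lp.const 2 μ (1 : ℂ) : (quasiSplit F E c 2).L2 μ) = h1m.toLp _ := by
    refine Lp.ext ?_
    filter_upwards [Lp.coeFn_const 2 μ (1 : ℂ), h1m.coeFn_toLp] with x hx hx'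
    rw [hx, hx']
    rfl
  have hΛ1 : Λ (Lp.const 2 μ (1 : ℂ)) = ∫ y, ((h y : ℝ) : ℂ) ∂νG := by
    rw [hc1, (hΛ _ h1G h1m).2]
    simp only [mul_one]
  -- a uniform height bound on `g·supp h`, measurability of the top function
  obtain ⟨B, hB1, hB⟩ := exists_forall_supHeight_le_of_hasCompactSupport hhc g
  have hWm : Measurable fun y : (quasiSplit F E c 2).Adelic => supHeight F E c 2 ((quasiSplit F E c 2).toAutomorphicQuotient (g * y)⁻¹) :=
    measurable_supHeight.comp ((quasiSplit F E c 2).continuous_toAutomorphicQuotient.comp (continuous_const.mul continuous_id).inv).measurable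
  -- the top integrand is integrable for every `z` (bounded, Borel, supported in `supp h`)
  have htopI : ∀ z : ℂ, Integrable (fun y => ((h y : ℝ) : ℂ) * (if T < supHeight F E c 2 ((quasiSplit F E c 2).toAutomorphicQuotient (g * y)⁻¹) then
      φ₀ * ((((supHeight F E c 2 ((quasiSplit F E c 2).toAutomorphicQuotient (g * y)⁻¹) : ℝ≥0) : ℝ) : ℂ) ^ z +
        cc z * (((supHeight F E c 2 ((quasiSplit F E c 2).toAutomorphicQuotient (g * y)⁻¹) : ℝ≥0) : ℝ) : ℂ) ^ (1 - z)) else 0)) νG := by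
    intro z
    have hmeas : Measurable fun y : (quasiSplit F E c 2).Adelic => (if T < supHeight F E c 2 ((quasiSplit F E c 2).toAutomorphicQuotient (g * y)⁻¹) then
        φ₀ * ((((supHeight F E c 2 ((quasiSplit F E c 2).toAutomorphicQuotient (g * y)⁻¹) : ℝ≥0) : ℝ) : ℂ) ^ z +
          cc z * (((supHeight F E c 2 ((quasiSplit F E c 2).toAutomorphicQuotient (g * y)⁻¹) : ℝ≥0) : ℝ) : ℂ) ^ (1 - z)) else 0) := by
      have hWc : Measurable fun y : (quasiSplit F E c 2).Adelic => (((supHeight F E c 2 ((quasiSplit F E c 2).toAutomorphicQuotient (g * y)⁻¹) : ℝ≥0) : ℝ) : ℂ) :=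
        Complex.measurable_ofReal.comp (measurable_coe_nnreal_real.comp hWm)
      exact Measurable.ite (measurableSet_lt measurable_const hWm) (measurable_const.mul ((hWc.pow_const z).add (measurable_const.mul (hWc.pow measurable_const)))) measurable_const
    -- a bound on `supp h`
    set M : ℝ := ‖φ₀‖ * ((B : ℝ) ^ |z.re| + ‖cc z‖ * (B : ℝ) ^ |(1 - z).re|) with hM
    have hbd : ∀ y, ‖((h y : ℝ) : ℂ) * (if T < supHeight F E c 2 ((quasiSplit F E c 2).toAutomorphicQuotient (g * y)⁻¹) then
        φ₀ * ((((supHeight F E c 2 ((quasiSplit F E c 2).toAutomorphicQuotient (g * y)⁻¹) : ℝ≥0) : ℝ) : ℂ) ^ z +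
          cc z * (((supHeight F E c 2 ((quasiSplit F E c 2).toAutomorphicQuotient (g * y)⁻¹) : ℝ≥0) : ℝ) : ℂ) ^ (1 - z)) else 0)‖ ≤ ‖h y‖ * M := by
      intro y
      by_cases hy : y ∈ tsupport h
      · rw [norm_mul, Complex.norm_real]
        refine mul_le_mul_of_nonneg_left ?_ (norm_nonneg _)
        split_ifs with hlt
        · set W : ℝ≥0 := supHeight F E c 2 ((quasiSplit F E c 2).toAutomorphicQuotient (g * y)⁻¹) with hW
          have hW1 : (1 : ℝ) ≤ (W : ℝ) := by exact_mod_cast hT.trans hlt.le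
          have hWB : (W : ℝ) ≤ (B : ℝ) := by exact_mod_cast hB y hy
          have hB1' : (1 : ℝ) ≤ (B : ℝ) := by exact_mod_cast hB1
          have hpow : ∀ s : ℂ, ‖(((W : ℝ≥0) : ℝ) : ℂ) ^ s‖ ≤ (B : ℝ) ^ |s.re| := fun s => by
            rw [Complex.norm_cpow_eq_rpow_re_of_pos (by linarith)]
            rcases le_or_gt 0 s.re with hs | hs
            · rw [abs_of_nonneg hs]; exact Real.rpow_le_rpow (by linarith) hWB hs
            · exact (Real.rpow_le_one_of_one_le_of_nonpos hW1 hs.le).trans (Real.one_le_rpow hB1' (abs_nonneg _))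
          rw [hM, norm_mul]
          refine mul_le_mul_of_nonneg_left ((norm_add_le _ _).trans (add_le_add (hpow z) ?_)) (norm_nonneg _)
          rw [norm_mul]
          exact mul_le_mul_of_nonneg_left (hpow (1 - z)) (norm_nonneg _)
        · rw [norm_zero]; positivity
      · rw [image_eq_zero_of_notMem_tsupport hy, Complex.ofReal_zero, zero_mul, norm_zero]; positivity
    exact Integrable.mono' ((hh.norm.mul continuous_const).integrable_of_hasCompactSupport (hhc.norm.mul_right)) ((Complex.continuous_ofReal.comp hh).measurable.mul hmeas).aestronglyMeasurable
      (ae_of_all _ hbd)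
  refine ⟨Λ, hΛ1, fun z _ => htopI z, fun z hz => ?_⟩
  -- the truncated function: `G(F)`-invariant with class `Fam z`
  have hTrG : ∀ γ ∈ (quasiSplit F E c 2).quotientSubgroup, ∀ y, truncation ν 𝓕 T (Ec z) (γ * y) = truncation ν 𝓕 T (Ec z) y := fun γ hγ y => by
    rw [quotientSubgroup_quasiSplit] at hγ
    exact truncation_rational_mul ν h𝓕 T (hEcinv z hz) ⟨γ, hγ⟩ y
  have hm : MemLp ((quasiSplit F E c 2).quotFun (truncation ν 𝓕 T (Ec z))) 2 μ := (Lp.memLp (Fam z)).ae_eq (hFam z hz)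
  have hFz : Fam z = hm.toLp _ := by
    refine Lp.ext ?_
    filter_upwards [hFam z hz, hm.coeFn_toLp] with x hx hx'
    rw [hx, hx']
  obtain ⟨hintT, hΛT⟩ := hΛ _ hTrG hm
  -- the Siegel-top formula at the points `g y`
  have htop : ∀ y : (quasiSplit F E c 2).Adelic, truncation ν 𝓕 T (Ec z) (g * y) = Ec z (g * y) -
      (if T < supHeight F E c 2 ((quasiSplit F E c 2).toAutomorphicQuotient (g * y)⁻¹) then
        φ₀ * ((((supHeight F E c 2 ((quasiSplit F E c 2).toAutomorphicQuotient (g * y)⁻¹) : ℝ≥0) : ℝ) : ℂ) ^ z +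
          cc z * (((supHeight F E c 2 ((quasiSplit F E c 2).toAutomorphicQuotient (g * y)⁻¹) : ℝ≥0) : ℝ) : ℂ) ^ (1 - z)) else 0) := fun y => by
    rw [truncation_continued_apply ν h𝓕 hT (hEcinv z hz) (Φ := fun t => φ₀ * ((((t : ℝ≥0) : ℝ) : ℂ) ^ z + cc z * (((t : ℝ≥0) : ℝ) : ℂ) ^ (1 - z))) (fun g' => hE3 z hz g') (g * y),
      supHeight_toAutomorphicQuotient, inv_inv]
  -- `∫ h·Ẽ(z)(g·) = ∫ h·Λ^TẼ(z)(g·) + ∫ h·top`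
  have hsplit : ∫ y, ((h y : ℝ) : ℂ) * Ec z (g * y) ∂νG = ∫ y, ((h y : ℝ) : ℂ) * truncation ν 𝓕 T (Ec z) (g * y) ∂νG +
      ∫ y, ((h y : ℝ) : ℂ) * (if T < supHeight F E c 2 ((quasiSplit F E c 2).toAutomorphicQuotient (g * y)⁻¹) then
        φ₀ * ((((supHeight F E c 2 ((quasiSplit F E c 2).toAutomorphicQuotient (g * y)⁻¹) : ℝ≥0) : ℝ) : ℂ) ^ z +
          cc z * (((supHeight F E c 2 ((quasiSplit F E c 2).toAutomorphicQuotient (g * y)⁻¹) : ℝ≥0) : ℝ) : ℂ) ^ (1 - z)) else 0) ∂νG := by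
    rw [← integral_add hintT (htopI z)]
    refine integral_congr_ae (ae_of_all _ fun y => ?_)
    simp only [htop y]
    ring
  rw [← hHk z hz g, hsplit, hFz, hΛT]

end Link

/-! ## §2 From `L²` bounds to pointwise bounds: pole exclusion off `1` and the simple-pole letter at `1` -/

section Bounds

variable (μ : Measure (quasiSplit F E c 2).automorphicQuotient) [(quasiSplit F E c 2).IsAutomorphicMeasure μ]
  (νG : Measure (quasiSplit F E c 2).Adelic) [νG.IsHaarMeasure] [νG.IsInvInvariant]

/-- **`L²` BOUNDS ON THE WEIGHTED TRUNCATED FAMILY GIVE POINTWISE BOUNDS ON THE WEIGHTED CONTINUED VALUES.**  In the setting of §1 (`S ∈ 𝓝[≠] z₀`, `ĥ` continuous and non-zero at `z₀`),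
for a scalar weight `a : ℂ → ℂ` with `‖a z‖ ≤ A`, `‖a z · c̃ z‖ ≤ C_c` and `‖a z • F_T z‖_{L²} ≤ C_F` near `z₀`: **`∃ C, ‖a(z)·Ẽ(z)(g)‖ ≤ C` near `z₀`** — by the link,
`ĥ(z)·a(z)Ẽ(z)(g) = Λ_g(a(z)•F_T(z)) + a(z)R_g(z)` with `‖a(z)R_g(z)‖ ≤ ‖h‖₁‖φ₀‖(A·B^{|Re z|} + C_c·B^{|1−Re z|})` and `|ĥ(z)| ≥ |ĥ(z₀)|∕2` near `z₀`.
[cite: BernsteinLapid2019, §4 p. 10] [cite: MoeglinWaldspurger1995, IV.1.11] -/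
theorem exists_eventually_norm_mul_le_of_family_bound (ν : Measure ↥(adelicUnipotent F E c 2)) [ν.IsHaarMeasure] {𝓕 : Set ↥(adelicUnipotent F E c 2)}
    (h𝓕 : IsFundamentalDomain ↥(rationalUnipotent F E c 2) 𝓕 ν) {T : ℝ≥0} (hT : 1 ≤ T) (φ₀ : ℂ)
    {h : (quasiSplit F E c 2).Adelic → ℝ} (hh : Continuous h) (hhc : HasCompactSupport h) {hhat : ℂ → ℂ} {z₀ : ℂ} (hha : ContinuousAt hhat z₀) (hha0 : hhat z₀ ≠ 0)
    (Ec : ℂ → (quasiSplit F E c 2).Adelic → ℂ) {S : Set ℂ} (hS : ∀ᶠ z in 𝓝[≠] z₀, z ∈ S)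
    (hEcinv : ∀ z ∈ S, ∀ (γ : (quasiSplit F E c 2).arithmeticSubgroup) (x : (quasiSplit F E c 2).Adelic), Ec z ((γ : (quasiSplit F E c 2).Adelic) * x) = Ec z x)
    (hHk : ∀ z ∈ S, ∀ g : (quasiSplit F E c 2).Adelic, ∫ y, ((h y : ℝ) : ℂ) * Ec z (g * y) ∂νG = hhat z * Ec z g)
    (cc : ℂ → ℂ) (hE3 : ∀ z ∈ S, ∀ g : (quasiSplit F E c 2).Adelic,
      borelConstantTerm ν 𝓕 (Ec z) g = φ₀ * ((((borelHeight g : ℝ≥0) : ℝ) : ℂ) ^ z + cc z * (((borelHeight g : ℝ≥0) : ℝ) : ℂ) ^ (1 - z)))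
    (Fam : ℂ → (quasiSplit F E c 2).L2 μ)
    (hFam : ∀ z ∈ S, ((Fam z : (quasiSplit F E c 2).L2 μ) : (quasiSplit F E c 2).automorphicQuotient → ℂ) =ᵐ[μ] (quasiSplit F E c 2).quotFun (truncation ν 𝓕 T (Ec z)))
    (a : ℂ → ℂ) (haA : ∃ A : ℝ, ∀ᶠ z in 𝓝[≠] z₀, ‖a z‖ ≤ A) (hacc : ∃ C : ℝ, ∀ᶠ z in 𝓝[≠] z₀, ‖a z * cc z‖ ≤ C) (haF : ∃ C : ℝ, ∀ᶠ z in 𝓝[≠] z₀, ‖a z • Fam z‖ ≤ C)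
    (g : (quasiSplit F E c 2).Adelic) :
    ∃ C : ℝ, ∀ᶠ z in 𝓝[≠] z₀, ‖a z * Ec z g‖ ≤ C := by
  obtain ⟨Λ, -, hint, hlink⟩ := exists_clm_hecke_link μ νG ν h𝓕 hT φ₀ hh hhc hhat Ec S hEcinv hHk cc hE3 Fam hFam g
  obtain ⟨B, hB1, hB⟩ := exists_forall_supHeight_le_of_hasCompactSupport hhc g
  obtain ⟨A, hA⟩ := haA
  obtain ⟨Cc, hCc⟩ := hacc
  obtain ⟨CF, hCF⟩ := haF
  have hB1' : (1 : ℝ) ≤ (B : ℝ) := by exact_mod_cast hB1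
  -- `|Re z| ≤ |Re z₀| + 1` near `z₀`
  have hre : ∀ᶠ z in 𝓝[≠] z₀, |z.re| ≤ |z₀.re| + 1 ∧ |(1 - z).re| ≤ |z₀.re| + 2 := by
    have hball : ball z₀ 1 ∈ 𝓝[≠] z₀ := mem_nhdsWithin_of_mem_nhds (ball_mem_nhds _ one_pos)
    filter_upwards [hball] with z hz
    rw [mem_ball, Complex.dist_eq] at hz
    have h1 : |z.re - z₀.re| ≤ 1 := by
      have := Complex.abs_re_le_norm (z - z₀); rw [Complex.sub_re] at this; linarith
    have hzre : |z.re| ≤ |z₀.re| + 1 :=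
      calc |z.re| = |(z.re - z₀.re) + z₀.re| := by congr 1; ring
        _ ≤ |z.re - z₀.re| + |z₀.re| := abs_add_le _ _
        _ ≤ |z₀.re| + 1 := by linarith
    refine ⟨hzre, ?_⟩
    rw [Complex.sub_re, Complex.one_re]
    calc |1 - z.re| ≤ |(1 : ℝ)| + |z.re| := abs_sub _ _
      _ ≤ |z₀.re| + 2 := by rw [abs_one]; linarith
  -- `|ĥ z| ≥ |ĥ z₀| / 2` near `z₀`
  have hhat_lb : ∀ᶠ z in 𝓝[≠] z₀, ‖hhat z₀‖ / 2 ≤ ‖hhat z‖ := by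
    have hpos : 0 < ‖hhat z₀‖ / 2 := by positivity
    have hev : ∀ᶠ z in 𝓝 z₀, dist (hhat z) (hhat z₀) < ‖hhat z₀‖ / 2 := hha.tendsto (ball_mem_nhds _ hpos)
    filter_upwards [mem_nhdsWithin_of_mem_nhds hev] with z hz
    rw [dist_eq_norm] at hz
    have := norm_sub_norm_le (hhat z₀) (hhat z)
    rw [← norm_neg (hhat z₀ - hhat z), neg_sub] at this
    linarith
  -- the bound on the top integral `a z · R_g(z)`
  set Ih : ℝ := ∫ y, ‖h y‖ ∂νG with hIh
  have hIh0 : 0 ≤ Ih := integral_nonneg fun _ => norm_nonneg _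
  set CR : ℝ := Ih * (‖φ₀‖ * (A * (B : ℝ) ^ (|z₀.re| + 1) + Cc * (B : ℝ) ^ (|z₀.re| + 2))) with hCR
  refine ⟨(CF * ‖Λ‖ + CR) / (‖hhat z₀‖ / 2), ?_⟩
  filter_upwards [hS, hA, hCc, hCF, hre, hhat_lb] with z hz hAz hCz hFz hrez hhz
  have hhz0 : 0 < ‖hhat z‖ := lt_of_lt_of_le (by positivity) hhz
  -- `ĥ z · (a z · Ẽ z g) = Λ (a z • Fam z) + a z · R z`
  have hkey := hlink z hz
  set R : ℂ := ∫ y, ((h y : ℝ) : ℂ) * (if T < supHeight F E c 2 ((quasiSplit F E c 2).toAutomorphicQuotient (g * y)⁻¹) then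
      φ₀ * ((((supHeight F E c 2 ((quasiSplit F E c 2).toAutomorphicQuotient (g * y)⁻¹) : ℝ≥0) : ℝ) : ℂ) ^ z +
        cc z * (((supHeight F E c 2 ((quasiSplit F E c 2).toAutomorphicQuotient (g * y)⁻¹) : ℝ≥0) : ℝ) : ℂ) ^ (1 - z)) else 0) ∂νG with hRdef
  have hid : hhat z * (a z * Ec z g) = Λ (a z • Fam z) + a z * R := by
    rw [map_smul, smul_eq_mul, ← mul_assoc, mul_comm (hhat z) (a z), mul_assoc, hkey, mul_add]
  -- `‖a z · R‖ ≤ CR`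
  have hRbd : ‖a z * R‖ ≤ CR := by
    rw [hRdef, ← smul_eq_mul (a := a z), ← integral_smul]
    refine (norm_integral_le_integral_norm _).trans ?_
    have hpt : ∀ y, ‖a z • (((h y : ℝ) : ℂ) * (if T < supHeight F E c 2 ((quasiSplit F E c 2).toAutomorphicQuotient (g * y)⁻¹) then
        φ₀ * ((((supHeight F E c 2 ((quasiSplit F E c 2).toAutomorphicQuotient (g * y)⁻¹) : ℝ≥0) : ℝ) : ℂ) ^ z +
          cc z * (((supHeight F E c 2 ((quasiSplit F E c 2).toAutomorphicQuotient (g * y)⁻¹) : ℝ≥0) : ℝ) : ℂ) ^ (1 - z)) else 0))‖ ≤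
        ‖h y‖ * (‖φ₀‖ * (A * (B : ℝ) ^ (|z₀.re| + 1) + Cc * (B : ℝ) ^ (|z₀.re| + 2))) := by
      intro y
      have hA0 : 0 ≤ A := (norm_nonneg _).trans hAz
      have hCc0 : 0 ≤ Cc := (norm_nonneg _).trans hCz
      by_cases hy : y ∈ tsupport h
      · rw [norm_smul, norm_mul, Complex.norm_real, mul_left_comm]
        refine mul_le_mul_of_nonneg_left ?_ (norm_nonneg _)
        split_ifs with hlt
        · set W : ℝ≥0 := supHeight F E c 2 ((quasiSplit F E c 2).toAutomorphicQuotient (g * y)⁻¹) with hW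
          have hW1 : (1 : ℝ) ≤ (W : ℝ) := by exact_mod_cast hT.trans hlt.le
          have hWB : (W : ℝ) ≤ (B : ℝ) := by exact_mod_cast hB y hy
          have hpow : ∀ (s : ℂ) (e : ℝ), |s.re| ≤ e → ‖(((W : ℝ≥0) : ℝ) : ℂ) ^ s‖ ≤ (B : ℝ) ^ e := fun s e hse => by
            rw [Complex.norm_cpow_eq_rpow_re_of_pos (by linarith)]
            rcases le_or_gt 0 s.re with hs | hs
            · exact (Real.rpow_le_rpow (by linarith) hWB hs).trans (Real.rpow_le_rpow_of_exponent_le hB1' ((le_abs_self _).trans hse))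
            · exact (Real.rpow_le_one_of_one_le_of_nonpos hW1 hs.le).trans (Real.one_le_rpow hB1' ((abs_nonneg _).trans hse))
          calc ‖a z‖ * ‖φ₀ * ((((W : ℝ≥0) : ℝ) : ℂ) ^ z + cc z * (((W : ℝ≥0) : ℝ) : ℂ) ^ (1 - z))‖
              = ‖φ₀‖ * ‖a z * (((W : ℝ≥0) : ℝ) : ℂ) ^ z + (a z * cc z) * (((W : ℝ≥0) : ℝ) : ℂ) ^ (1 - z)‖ := by
                rw [← norm_mul, ← norm_mul]; congr 1; ring
            _ ≤ ‖φ₀‖ * (‖a z‖ * (B : ℝ) ^ (|z₀.re| + 1) + Cc * (B : ℝ) ^ (|z₀.re| + 2)) := by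
                refine mul_le_mul_of_nonneg_left ((norm_add_le _ _).trans (add_le_add ?_ ?_)) (norm_nonneg _)
                · rw [norm_mul]; exact mul_le_mul_of_nonneg_left (hpow z _ hrez.1) (norm_nonneg _)
                · rw [norm_mul]; exact mul_le_mul hCz (hpow (1 - z) _ hrez.2) (norm_nonneg _) hCc0
            _ ≤ ‖φ₀‖ * (A * (B : ℝ) ^ (|z₀.re| + 1) + Cc * (B : ℝ) ^ (|z₀.re| + 2)) := by gcongr
        · rw [norm_zero, mul_zero]; positivity
      · rw [image_eq_zero_of_notMem_tsupport hy, Complex.ofReal_zero, zero_mul, smul_zero, norm_zero, norm_zero, zero_mul]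
    calc ∫ y, ‖a z • (((h y : ℝ) : ℂ) * (if T < supHeight F E c 2 ((quasiSplit F E c 2).toAutomorphicQuotient (g * y)⁻¹) then
            φ₀ * ((((supHeight F E c 2 ((quasiSplit F E c 2).toAutomorphicQuotient (g * y)⁻¹) : ℝ≥0) : ℝ) : ℂ) ^ z +
              cc z * (((supHeight F E c 2 ((quasiSplit F E c 2).toAutomorphicQuotient (g * y)⁻¹) : ℝ≥0) : ℝ) : ℂ) ^ (1 - z)) else 0))‖ ∂νG
        ≤ ∫ y, ‖h y‖ * (‖φ₀‖ * (A * (B : ℝ) ^ (|z₀.re| + 1) + Cc * (B : ℝ) ^ (|z₀.re| + 2))) ∂νG :=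
          integral_mono_of_nonneg (ae_of_all _ fun _ => norm_nonneg _) ((hh.norm.integrable_of_hasCompactSupport hhc.norm).mul_const _) (ae_of_all _ hpt)
      _ = CR := by rw [integral_mul_const, hCR]
  -- assemble: `‖a z Ẽ z g‖ = ‖Λ(a•F) + aR‖ / ‖ĥ z‖`
  have hnorm : ‖a z * Ec z g‖ * ‖hhat z‖ = ‖Λ (a z • Fam z) + a z * R‖ := by
    rw [← hid, norm_mul (hhat z), mul_comm]
  rw [le_div_iff₀ (by positivity)]
  calc ‖a z * Ec z g‖ * (‖hhat z₀‖ / 2) ≤ ‖a z * Ec z g‖ * ‖hhat z‖ := mul_le_mul_of_nonneg_left hhz (norm_nonneg _)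
    _ = ‖Λ (a z • Fam z) + a z * R‖ := hnorm
    _ ≤ CF * ‖Λ‖ + CR := by
        refine (norm_add_le _ _).trans (add_le_add ?_ hRbd)
        calc ‖Λ (a z • Fam z)‖ ≤ ‖Λ‖ * ‖a z • Fam z‖ := Λ.le_opNorm _
          _ ≤ ‖Λ‖ * CF := mul_le_mul_of_nonneg_left hFz (norm_nonneg _)
          _ = CF * ‖Λ‖ := mul_comm _ _

/-- **POLE EXCLUSION, POINTWISE** (the letter `hbdd` of ★ `hreg_cm_two_of_letters` at a point `z₀` where the truncated family is `L²`-bounded): if `‖F_T(z)‖_{L²} ≤ C` and `|c̃(z)| ≤ C` near `z₀`, `ĥ(z₀) ≠ 0`, then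
`∃ C', ‖Ẽ(z)(g)‖ ≤ C'` near `z₀`, for every `g`. [cite: BernsteinLapid2019, §4 p. 10] [cite: MoeglinWaldspurger1995, IV.1.11] -/
theorem exists_eventually_norm_le_of_family_bound (ν : Measure ↥(adelicUnipotent F E c 2)) [ν.IsHaarMeasure] {𝓕 : Set ↥(adelicUnipotent F E c 2)}
    (h𝓕 : IsFundamentalDomain ↥(rationalUnipotent F E c 2) 𝓕 ν) {T : ℝ≥0} (hT : 1 ≤ T) (φ₀ : ℂ)
    {h : (quasiSplit F E c 2).Adelic → ℝ} (hh : Continuous h) (hhc : HasCompactSupport h) {hhat : ℂ → ℂ} {z₀ : ℂ} (hha : ContinuousAt hhat z₀) (hha0 : hhat z₀ ≠ 0)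
    (Ec : ℂ → (quasiSplit F E c 2).Adelic → ℂ) {S : Set ℂ} (hS : ∀ᶠ z in 𝓝[≠] z₀, z ∈ S)
    (hEcinv : ∀ z ∈ S, ∀ (γ : (quasiSplit F E c 2).arithmeticSubgroup) (x : (quasiSplit F E c 2).Adelic), Ec z ((γ : (quasiSplit F E c 2).Adelic) * x) = Ec z x)
    (hHk : ∀ z ∈ S, ∀ g : (quasiSplit F E c 2).Adelic, ∫ y, ((h y : ℝ) : ℂ) * Ec z (g * y) ∂νG = hhat z * Ec z g)
    (cc : ℂ → ℂ) (hE3 : ∀ z ∈ S, ∀ g : (quasiSplit F E c 2).Adelic,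
      borelConstantTerm ν 𝓕 (Ec z) g = φ₀ * ((((borelHeight g : ℝ≥0) : ℝ) : ℂ) ^ z + cc z * (((borelHeight g : ℝ≥0) : ℝ) : ℂ) ^ (1 - z)))
    (Fam : ℂ → (quasiSplit F E c 2).L2 μ)
    (hFam : ∀ z ∈ S, ((Fam z : (quasiSplit F E c 2).L2 μ) : (quasiSplit F E c 2).automorphicQuotient → ℂ) =ᵐ[μ] (quasiSplit F E c 2).quotFun (truncation ν 𝓕 T (Ec z)))
    (hccb : ∃ C : ℝ, ∀ᶠ z in 𝓝[≠] z₀, ‖cc z‖ ≤ C) (hFb : ∃ C : ℝ, ∀ᶠ z in 𝓝[≠] z₀, ‖Fam z‖ ≤ C) (g : (quasiSplit F E c 2).Adelic) :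
    ∃ C : ℝ, ∀ᶠ z in 𝓝[≠] z₀, ‖Ec z g‖ ≤ C := by
  obtain ⟨C, hC⟩ := exists_eventually_norm_mul_le_of_family_bound μ νG ν h𝓕 hT φ₀ hh hhc hha hha0 Ec hS hEcinv hHk cc hE3 Fam hFam (fun _ => (1 : ℂ))
    ⟨1, Eventually.of_forall fun _ => by rw [norm_one]⟩ (by simpa only [one_mul] using hccb) (by simpa only [one_smul] using hFb) g
  exact ⟨C, hC.mono fun z hz => by simpa only [one_mul] using hz⟩

/-- **THE SIMPLE-POLE LETTER (F) AT `z = 1`** (the input `hF`∕`hFE` of ★ p859977∕p860015∕p860098 and of ★ `hres_cm_two_of_letters`): if `‖(z−1)•F_T(z)‖_{L²} ≤ C` (the Maass–Selberg bound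
at the pole) and `|(z−1)c̃(z)| ≤ C` near `1` (e.g. `(z−1)c̃(z) → r`), `ĥ(1) ≠ 0`, and `z ↦ Ẽ(z)(g)` is holomorphic on a punctured neighbourhood of `1`, then `(z−1)Ẽ(z)(g)` is bounded near
`1`, hence extends analytically across `1` (★ removable-singularity brick): `∃ Fg` analytic at `1` with `Fg =ᶠ[𝓝[≠] 1] (z ↦ (z−1)Ẽ(z)(g))`. [cite: MoeglinWaldspurger1995, IV.1.11] [cite: BernsteinLapid2019, §4 p. 10] -/
theorem exists_analyticAt_eventuallyEq_sub_mul_of_family_bound (ν : Measure ↥(adelicUnipotent F E c 2)) [ν.IsHaarMeasure] {𝓕 : Set ↥(adelicUnipotent F E c 2)}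
    (h𝓕 : IsFundamentalDomain ↥(rationalUnipotent F E c 2) 𝓕 ν) {T : ℝ≥0} (hT : 1 ≤ T) (φ₀ : ℂ)
    {h : (quasiSplit F E c 2).Adelic → ℝ} (hh : Continuous h) (hhc : HasCompactSupport h) {hhat : ℂ → ℂ} (hha : ContinuousAt hhat 1) (hha0 : hhat 1 ≠ 0)
    (Ec : ℂ → (quasiSplit F E c 2).Adelic → ℂ) {S : Set ℂ} (hS : ∀ᶠ z in 𝓝[≠] (1 : ℂ), z ∈ S)
    (hEcinv : ∀ z ∈ S, ∀ (γ : (quasiSplit F E c 2).arithmeticSubgroup) (x : (quasiSplit F E c 2).Adelic), Ec z ((γ : (quasiSplit F E c 2).Adelic) * x) = Ec z x)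
    (hHk : ∀ z ∈ S, ∀ g : (quasiSplit F E c 2).Adelic, ∫ y, ((h y : ℝ) : ℂ) * Ec z (g * y) ∂νG = hhat z * Ec z g)
    (cc : ℂ → ℂ) (hE3 : ∀ z ∈ S, ∀ g : (quasiSplit F E c 2).Adelic,
      borelConstantTerm ν 𝓕 (Ec z) g = φ₀ * ((((borelHeight g : ℝ≥0) : ℝ) : ℂ) ^ z + cc z * (((borelHeight g : ℝ≥0) : ℝ) : ℂ) ^ (1 - z)))
    (Fam : ℂ → (quasiSplit F E c 2).L2 μ)
    (hFam : ∀ z ∈ S, ((Fam z : (quasiSplit F E c 2).L2 μ) : (quasiSplit F E c 2).automorphicQuotient → ℂ) =ᵐ[μ] (quasiSplit F E c 2).quotFun (truncation ν 𝓕 T (Ec z)))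
    (hcc1 : ∃ C : ℝ, ∀ᶠ z in 𝓝[≠] (1 : ℂ), ‖(z - 1) * cc z‖ ≤ C) (hMS1 : ∃ C : ℝ, ∀ᶠ z in 𝓝[≠] (1 : ℂ), ‖(z - 1) • Fam z‖ ≤ C)
    (hEd1 : ∀ g : (quasiSplit F E c 2).Adelic, ∀ᶠ z in 𝓝[≠] (1 : ℂ), DifferentiableAt ℂ (fun z => Ec z g) z) (g : (quasiSplit F E c 2).Adelic) :
    (∃ C : ℝ, ∀ᶠ z in 𝓝[≠] (1 : ℂ), ‖(z - 1) * Ec z g‖ ≤ C) ∧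
      ∃ Fg : ℂ → ℂ, AnalyticAt ℂ Fg 1 ∧ Fg =ᶠ[𝓝[≠] 1] fun z => (z - 1) * Ec z g := by
  have hA : ∃ A : ℝ, ∀ᶠ z in 𝓝[≠] (1 : ℂ), ‖z - 1‖ ≤ A := by
    refine ⟨1, ?_⟩
    filter_upwards [mem_nhdsWithin_of_mem_nhds (ball_mem_nhds (1 : ℂ) one_pos)] with z hz
    rw [mem_ball, dist_eq_norm] at hz
    exact hz.le
  have hb := exists_eventually_norm_mul_le_of_family_bound μ νG ν h𝓕 hT φ₀ hh hhc hha hha0 Ec hS hEcinv hHk cc hE3 Fam hFam (fun z => z - 1) hA hcc1 hMS1 g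
  refine ⟨hb, ?_⟩
  have hd : ∀ᶠ z in 𝓝[≠] (1 : ℂ), DifferentiableAt ℂ (fun z => (z - 1) * Ec z g) z :=
    (hEd1 g).mono fun z hz => (differentiableAt_id.sub (differentiableAt_const _)).mul hz
  exact exists_analyticAt_eventuallyEq_of_differentiableAt_of_eventually_norm_le (X := ℂ) hd hb

end Bounds

end Summit.HodgeConjecture.HodgeConjecture.Cruxes.H413.K2E1SphericalEisensteinHeckeLinkFixedLevelUTwo

end
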